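import Literature.NumberTheory.EllipticCurves.KatoRankBoundAllPrimesSkeletonProofs
import HarnessLib

/-!
# Kato 2004 (Astérisque 295) §17.13 — the module theory with a Coleman map that is only injective
# UP TO `c`-TORSION, and the descent algebra that produces such a map: an injective map equivariant
# for an involution descends to the coinvariants with kernel killed by `2`

Topic `NumberTheory/EllipticCurves` (sibling of `KatoRankBoundAllPrimesSkeletonProofs`,
`KatoDivisibilityExceptionalZeroSkeletonProofs`). Cell `bsd-2adic` (rung K4 of
`BirchSwinnertonDyer`, class O1 = X5 at `p = 2`), seat `bsd-2adic-mult` GEN 10, HOME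
`run/shared/lean/pub/bsd-2adic/` (memo `mult/KERNEL-K11-COLEMAN-DESCENT.md`). HONEST FRAMING: PROVED
commutative algebra only (no named fact, nothing about elliptic curves is asserted); it is the
kernel half of the cell's reading of Kato's §17.13 at a NON-SPLIT multiplicative `2`, where the
Coleman map of the package `Kato2004.MultDivisibilityInputs` (file
`Kato2004/DivisibilityInputsMultiplicative`) is obtained from Kato's own tower `ℚ(ζ_{2^∞})` by a
`Δ = {±1}`-descent and is therefore injective only up to `2`-torsion. BSD is not advanced.

## What is proved

* `Module.lengthAt_le_of_smul_ker_eq_zero`: a linear map whose kernel is killed by some `c ∉ 𝔭`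
  does not increase local length at `𝔭` (`length M_𝔭 ≤ length N_𝔭`).
* §17.13's bookkeeping (Kato, p. 280: "length(P/loc 𝐇¹)_𝔭 + length(𝐇¹/Z)_𝔭 ≤ ord_𝔭(G)", there with
  `𝔏_η` INJECTIVE by Prop. 17.11) when the Coleman map `col : P → R` merely satisfies
  `col y = 0 ⇒ c·y = 0`: `Kato2004.smul_eq_col_smul_loc_upTo`, `isTorsion_of_skeleton_kerUpTo`
  (Thm. 17.4 (1)'s shape), `lengthAt_quotient_range_add_le_kerUpTo`,
  `lengthAt_le_of_skeleton_kerUpTo`, `thm17_4_skeleton_kerUpTo` (Thm. 17.4 (2)'s shape at the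
  primes `𝔭 ∌ c`), and over `Λ = ℤ_p⟦T⟧` the tree's form
  `exists_mem_charIdeal_of_skeleton_kerUpTo` (`X` torsion and `p^m·L ∈ ι(char_Λ X)`), with the
  admissible defect constants `two_mul_natCast_pow_ne_zero_and_not_mem` (`c = 2·p^a` lies in no
  height-one `𝔭 ∌ p`, for EVERY prime `p`: at `p = 2` because `𝔭 ∌ 2`, at odd `p` because `2` is a
  unit of `ℤ_p`).
* The descent algebra `Kato2004.two_smul_mem_range_of_descent` /
  `Kato2004.two_smul_eq_zero_of_descent`: let `𝓛 : M → N` be an INJECTIVE `R`-linear map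
  intertwining endomorphisms `cM`, `cN` (`𝓛 ∘ cM = cN ∘ 𝓛`), and `pr : N → R` a linear form with
  `pr ∘ cN = pr` whose kernel lies in the `(−1)`-eigenspace of `cN`; then the map
  `col : M/(cM − 1)M → R` induced by `pr ∘ 𝓛` has kernel killed by `2`
  (`x ↦ pr(𝓛 x) = 0 ⇒ cN(𝓛x) = −𝓛x ⇒ cM x = −x ⇒ 2x = (cM − 1)(−x)`). This is the situation of
  Kato's Perrin-Riou map `𝔏_η : 𝐇¹_loc(T(k))/𝐇¹_loc(T′(k)) ↪ Λ_G = O[Δ]⟦G¹_∞⟧` (Prop. 17.11, over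
  `ℚ_p(ζ_{p^∞})`, `Λ_G`-linear by Thm. 16.4) at `p = 2`, `Δ = {1, c}` (12.1: "`G¹_∞ = {σ; κ(σ) ≡ 1
  mod 4}` in the case `p = 2`"), `pr : Λ_G → ℤ₂⟦G¹_∞⟧` the projection `c ↦ 1` (kernel
  `(c − 1)Λ_G = {y : cy = −y}`): the descended Coleman map on the `Δ`-coinvariants is injective up
  to `2`-torsion — exactly the hypothesis of the first group of theorems with `c = 2`.

## What is NOT here

Any Galois cohomology, any named fact, the identification of the abstract modules with Kato's
(that is the business of the package file `Kato2004/DivisibilityInputsMultiplicativeDescent`), the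
integral clause 12.5 (4) / 17.4 (3), `μ`.

## References

* K. Kato, *p-adic Hodge theory and values of zeta functions of modular forms*, Astérisque 295
  (2004): 12.1 (pp. 219–220), Thm. 16.4 (p. 270), Prop. 17.11 / Lemma 17.12 (pp. 277–279), §17.13
  (pp. 279–280), 14.9 (p. 239). [Kato2004Asterisque]
* Tree: `KatoRankBoundAllPrimesSkeletonProofs` (the `Injective col` version and the local-length
  lemmas "up to `×c`"), `KatoDivisibilitySkeletonProofs` (`loc_injective`),
  `IwasawaAlgebraDivisibilityProofs` (`exists_pow_mul_mem_charIdeal_of_lengthAt_le`).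
-/

noncomputable section

namespace Literature.NumberTheory.EllipticCurves

/-! ### Local lengths: a kernel killed by `c ∉ 𝔭` is invisible at `𝔭` -/

namespace Module

section Defect

variable {R : Type*} [CommRing R] {M N : Type*} [AddCommGroup M] [_root_.Module R M]
  [AddCommGroup N] [_root_.Module R N]

/-- If the kernel of `g : M → N` is killed by some `c ∉ 𝔭`, then `length M_𝔭 ≤ length N_𝔭`
(`Ker(g)_𝔭 = 0`, so `M_𝔭 ↪ N_𝔭`: localisation is exact and `c` is a unit of `R_𝔭`).
[cite: Bourbaki1989CommAlg, Ch. II §2.4 (exactness of localisation; a module killed by an element of the multiplicative set localises to zero)] -/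
theorem lengthAt_le_of_smul_ker_eq_zero (g : M →ₗ[R] N) {c : R} (𝔭 : PrimeSpectrum R)
    (hc : c ∉ 𝔭.asIdeal) (h : ∀ x, g x = 0 → c • x = 0) :
    lengthAt R M 𝔭 ≤ lengthAt R N 𝔭 := by
  have h1 : lengthAt R M 𝔭 ≤ lengthAt R (⊥ : Submodule R M) 𝔭 + lengthAt R N 𝔭 :=
    lengthAt_le_add_of_smul_ker_le g ⊥ 𝔭 hc fun x hx => by
      rw [h x hx]
      exact Submodule.zero_mem _
  have h0 : lengthAt R (⊥ : Submodule R M) 𝔭 = 0 := lengthAt_eq_zero_of_subsingleton 𝔭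
  rwa [h0, zero_add] at h1

end Defect

end Module

namespace Kato2004

open Module

/-! ### §17.13 over a domain with `col` injective up to `c`-torsion -/

section SkeletonKerUpTo

variable {R : Type*} [CommRing R] [IsDomain R]
  {H P X H2 : Type*} [AddCommGroup H] [_root_.Module R H] [AddCommGroup P] [_root_.Module R P]
  [AddCommGroup X] [_root_.Module R X] [AddCommGroup H2] [_root_.Module R H2]

omit [IsDomain R] in
/-- With `col (loc z) = G` and `Ker(col)` killed by `c`: `(c·G) • y = (c · col y) • loc z` for every
`y ∈ P` (apply `col` to `G•y − col(y)•loc z`; Kato, §17.13, p. 280, there with `col` injective).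
[cite: Kato2004Asterisque, §17.13 (p. 280)] -/
theorem smul_eq_col_smul_loc_upTo (loc : H →ₗ[R] P) (col : P →ₗ[R] R) {c : R}
    (hcol : ∀ y : P, col y = 0 → c • y = 0) {z : H} {G : R} (hz : col (loc z) = G) (y : P) :
    (c * G) • y = (c * col y) • loc z := by
  have h0 : col (G • y - col y • loc z) = 0 := by
    simp only [map_sub, map_smul, hz, smul_eq_mul, mul_comm, sub_self]
  have h1 := hcol _ h0
  rw [smul_sub, smul_smul, smul_smul, sub_eq_zero] at h1
  exact h1

/-- **Thm. 17.4 (1), skeleton, Poitou–Tate exact up to `×c`, Coleman map injective up to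
`c`-torsion.** As `isTorsion_of_skeleton_upTo` (file `KatoRankBoundAllPrimesSkeletonProofs`) with
`Injective col` weakened to `col y = 0 ⇒ c • y = 0`: `X` is a torsion module.
[cite: Kato2004Asterisque, Thm 17.4 (1) (p. 273), §17.13 (pp. 279–280), 14.9 (p. 239)] -/
theorem isTorsion_of_skeleton_kerUpTo {c : R} (hc : c ≠ 0) (loc : H →ₗ[R] P) (toX : P →ₗ[R] X)
    (δ : X →ₗ[R] H2) (hPX : ∀ h : H, c • toX (loc h) = 0)
    (hXH : ∀ x : X, δ x = 0 → c • x ∈ LinearMap.range toX)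
    (col : P →ₗ[R] R) (hcol : ∀ y : P, col y = 0 → c • y = 0) {z : H} {G : R} (hG : G ≠ 0)
    (hz : col (loc z) = G) (hH2 : Module.IsTorsion R H2) : Module.IsTorsion R X := by
  intro x
  obtain ⟨⟨a, ha⟩, hax⟩ := @hH2 (δ x)
  have ha0 : a ≠ 0 := nonZeroDivisors.ne_zero ha
  have hδ : δ (a • x) = 0 := by rw [map_smul]; exact hax
  obtain ⟨y, hy⟩ := hXH _ hδ
  have key : (c * (c * G)) • ((c * a) • x) = 0 := by
    rw [mul_smul c a x, ← hy, mul_smul, ← map_smul, smul_eq_col_smul_loc_upTo loc col hcol hz y,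
      map_smul, smul_comm, hPX, smul_zero]
  refine ⟨⟨c * (c * G) * (c * a), mem_nonZeroDivisors_of_ne_zero
    (mul_ne_zero (mul_ne_zero hc (mul_ne_zero hc hG)) (mul_ne_zero hc ha0))⟩, ?_⟩
  rw [Submonoid.smul_def, mul_smul]
  exact key

omit [IsDomain R] in
/-- §17.13's bookkeeping (p. 280) with `loc` injective, `Ker(col)` killed by `c ∉ 𝔭` and
`G ∈ col(loc Z)`:
`length (P/loc H)_𝔭 + length (H/Z)_𝔭 = length (P/loc Z)_𝔭 ≤ length (R/col(loc Z))_𝔭 ≤ length (R/(G))_𝔭`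
— the middle step because `P/loc(Z) → R/col(loc Z)` has kernel `(Ker col + loc Z)/loc Z`, killed
by `c`. [cite: Kato2004Asterisque, §17.13 (p. 280)] -/
theorem lengthAt_quotient_range_add_le_kerUpTo (loc : H →ₗ[R] P) (hinj : Function.Injective loc)
    (col : P →ₗ[R] R) {c : R} (hcol : ∀ y : P, col y = 0 → c • y = 0) (Z : Submodule R H)
    {G : R} (hGZ : G ∈ Submodule.map (col ∘ₗ loc) Z) (𝔭 : PrimeSpectrum R)
    (hc : c ∉ 𝔭.asIdeal) :
    lengthAt R (P ⧸ LinearMap.range loc) 𝔭 + lengthAt R (H ⧸ Z) 𝔭 ≤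
      lengthAt R (R ⧸ Ideal.span {G}) 𝔭 := by
  obtain ⟨z, hzZ, hz⟩ := Submodule.mem_map.mp hGZ
  simp only [LinearMap.coe_comp, Function.comp_apply] at hz
  set LZ : Submodule R P := Submodule.map loc Z with hLZ
  have hLZle : LZ ≤ LinearMap.range loc := LinearMap.map_le_range
  set N : Submodule R (P ⧸ LZ) := Submodule.map LZ.mkQ (LinearMap.range loc) with hN
  have hQN : lengthAt R (P ⧸ LZ) 𝔭 = lengthAt R N 𝔭 + lengthAt R ((P ⧸ LZ) ⧸ N) 𝔭 :=
    lengthAt_eq_add_quotient N 𝔭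
  have hthird : lengthAt R ((P ⧸ LZ) ⧸ N) 𝔭 = lengthAt R (P ⧸ LinearMap.range loc) 𝔭 :=
    lengthAt_eq_of_linearEquiv (Submodule.quotientQuotientEquivQuotient LZ _ hLZle) 𝔭
  have hNeq : lengthAt R N 𝔭 = lengthAt R (H ⧸ Z) 𝔭 := by
    set g : H →ₗ[R] P ⧸ LZ := LZ.mkQ ∘ₗ loc with hg
    have hrange : LinearMap.range g = N := by
      rw [hg, LinearMap.range_comp, hN]
    have hker : LinearMap.ker g = Z := by
      rw [hg, LinearMap.ker_comp, Submodule.ker_mkQ, hLZ, Submodule.comap_map_eq_of_injective hinj]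
    calc lengthAt R N 𝔭 = lengthAt R (LinearMap.range g) 𝔭 := by rw [hrange]
      _ = lengthAt R (H ⧸ LinearMap.ker g) 𝔭 :=
          (lengthAt_eq_of_linearEquiv g.quotKerEquivRange 𝔭).symm
      _ = lengthAt R (H ⧸ Z) 𝔭 := by rw [hker]
  -- `P / LZ → R / col(LZ)` has kernel killed by `c`, and `R/(G) ↠ R / col(LZ)`
  set I : Ideal R := Submodule.map col LZ with hI
  have hGI : G ∈ I := ⟨loc z, ⟨z, hzZ, rfl⟩, hz⟩
  have hQI : lengthAt R (P ⧸ LZ) 𝔭 ≤ lengthAt R (R ⧸ I) 𝔭 := by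
    refine lengthAt_le_of_smul_ker_eq_zero (Submodule.mapQ LZ I col fun y hy => ⟨y, hy, rfl⟩) 𝔭 hc
      fun q hq => ?_
    obtain ⟨y, rfl⟩ := Submodule.Quotient.mk_surjective LZ q
    have hy : col y ∈ I := by
      rw [Submodule.mapQ_apply, Submodule.Quotient.mk_eq_zero] at hq
      exact hq
    obtain ⟨w, hw, hwy⟩ := hy
    have hk : col (y - w) = 0 := by rw [map_sub, hwy, sub_self]
    have hcy : c • (y - w) = 0 := hcol _ hk
    rw [← Submodule.Quotient.mk_smul, Submodule.Quotient.mk_eq_zero]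
    rw [smul_sub, sub_eq_zero] at hcy
    rw [hcy]
    exact LZ.smul_mem c hw
  have hIG : lengthAt R (R ⧸ I) 𝔭 ≤ lengthAt R (R ⧸ Ideal.span {G}) 𝔭 :=
    lengthAt_le_of_surjective (Submodule.factor ((Ideal.span_singleton_le_iff_mem I).mpr hGI))
      (Submodule.factor_surjective _) 𝔭
  calc lengthAt R (P ⧸ LinearMap.range loc) 𝔭 + lengthAt R (H ⧸ Z) 𝔭
        = lengthAt R (P ⧸ LZ) 𝔭 := by rw [hQN, hthird, hNeq, add_comm]
    _ ≤ lengthAt R (R ⧸ I) 𝔭 := hQI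
    _ ≤ lengthAt R (R ⧸ Ideal.span {G}) 𝔭 := hIG

/-- **Thm. 17.4 (2) at one prime, skeleton, Poitou–Tate exact up to `×c`, Coleman map injective up
to `c`-torsion.** As `lengthAt_le_of_skeleton_upTo` with `Injective col` weakened to
`col y = 0 ⇒ c • y = 0`: at every prime `𝔭 ∌ c` where the Euler-system bound
`length H2_𝔭 ≤ length (H/Z)_𝔭` holds, `length X_𝔭 ≤ length (R/(G))_𝔭`.
[cite: Kato2004Asterisque, Thm 17.4 (2) (p. 273), §17.13 (pp. 279–280), 14.9 (p. 239)] -/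
theorem lengthAt_le_of_skeleton_kerUpTo [Module.IsTorsionFree R H] (hrank : Module.rank R H ≤ 1)
    {c : R} (loc : H →ₗ[R] P) (toX : P →ₗ[R] X) (δ : X →ₗ[R] H2)
    (hPX : ∀ h : H, c • toX (loc h) = 0) (hXH : ∀ x : X, δ x = 0 → c • x ∈ LinearMap.range toX)
    (col : P →ₗ[R] R) (hcol : ∀ y : P, col y = 0 → c • y = 0) (Z : Submodule R H) {G : R}
    (hG : G ≠ 0) (hGZ : G ∈ Submodule.map (col ∘ₗ loc) Z) (𝔭 : PrimeSpectrum R)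
    (hc : c ∉ 𝔭.asIdeal) (hES : lengthAt R H2 𝔭 ≤ lengthAt R (H ⧸ Z) 𝔭) :
    lengthAt R X 𝔭 ≤ lengthAt R (R ⧸ Ideal.span {G}) 𝔭 := by
  obtain ⟨z, -, hz⟩ := Submodule.mem_map.mp hGZ
  simp only [LinearMap.coe_comp, Function.comp_apply] at hz
  have hinj : Function.Injective loc := loc_injective hrank loc col hG hz
  have h1 : lengthAt R X 𝔭 ≤ lengthAt R (LinearMap.range toX) 𝔭 + lengthAt R H2 𝔭 :=
    lengthAt_le_add_of_smul_ker_le δ (LinearMap.range toX) 𝔭 hc hXH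
  have h2 : lengthAt R (LinearMap.range toX) 𝔭 ≤ lengthAt R (P ⧸ LinearMap.range loc) 𝔭 := by
    rw [← lengthAt_eq_of_linearEquiv toX.quotKerEquivRange 𝔭]
    refine lengthAt_quotient_le_of_smul_mem 𝔭 hc ?_
    rintro _ ⟨h, rfl⟩
    rw [LinearMap.mem_ker, map_smul]
    exact hPX h
  calc lengthAt R X 𝔭 ≤ lengthAt R (LinearMap.range toX) 𝔭 + lengthAt R H2 𝔭 := h1
    _ ≤ lengthAt R (P ⧸ LinearMap.range loc) 𝔭 + lengthAt R (H ⧸ Z) 𝔭 := add_le_add h2 hES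
    _ ≤ lengthAt R (R ⧸ Ideal.span {G}) 𝔭 :=
        lengthAt_quotient_range_add_le_kerUpTo loc hinj col hcol Z hGZ 𝔭 hc

/-- **Kato, Thm. 17.4 (1)–(2), skeleton over a domain, (17.13.1) exact up to `×c` and the Coleman
map injective up to `c`-torsion** (the module theory of §17.13 at `p = 2` after a `Δ`-descent from
`ℚ(ζ_{2^∞})`: the descended `𝔏_η` has kernel killed by `2`, see `two_smul_eq_zero_of_descent`).
Conclusion: (1) `X` is torsion; (2) at every prime `𝔭 ∌ c` at which `length H2_𝔭 ≤ length (H/Z)_𝔭`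
holds, `length X_𝔭 ≤ length (R/(G))_𝔭`. For `Injective col` this is `thm17_4_skeleton_upTo`.
[cite: Kato2004Asterisque, Thm 17.4 (1)(2) (p. 273), §17.13 (pp. 279–280), 14.9 (p. 239)] -/
theorem thm17_4_skeleton_kerUpTo [Module.IsTorsionFree R H] (hrank : Module.rank R H ≤ 1)
    {c : R} (hc : c ≠ 0) (loc : H →ₗ[R] P) (toX : P →ₗ[R] X) (δ : X →ₗ[R] H2)
    (hPX : ∀ h : H, c • toX (loc h) = 0) (hXH : ∀ x : X, δ x = 0 → c • x ∈ LinearMap.range toX)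
    (col : P →ₗ[R] R) (hcol : ∀ y : P, col y = 0 → c • y = 0) (hH2 : Module.IsTorsion R H2)
    (Z : Submodule R H) {G : R} (hG : G ≠ 0) (hGZ : G ∈ Submodule.map (col ∘ₗ loc) Z) :
    Module.IsTorsion R X ∧
      ∀ 𝔭 : PrimeSpectrum R, c ∉ 𝔭.asIdeal → lengthAt R H2 𝔭 ≤ lengthAt R (H ⧸ Z) 𝔭 →
        lengthAt R X 𝔭 ≤ lengthAt R (R ⧸ Ideal.span {G}) 𝔭 := by
  obtain ⟨z, -, hz⟩ := Submodule.mem_map.mp hGZ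
  simp only [LinearMap.coe_comp, Function.comp_apply] at hz
  exact ⟨isTorsion_of_skeleton_kerUpTo hc loc toX δ hPX hXH col hcol hG hz hH2,
    fun 𝔭 hc𝔭 h𝔭 =>
      lengthAt_le_of_skeleton_kerUpTo hrank loc toX δ hPX hXH col hcol Z hG hGZ 𝔭 hc𝔭 h𝔭⟩

end SkeletonKerUpTo

/-! ### The descent algebra: coinvariants of an involution-equivariant injective map -/

section Descent

variable {R : Type*} [CommRing R] {M N : Type*} [AddCommGroup M] [_root_.Module R M]
  [AddCommGroup N] [_root_.Module R N]

/-- **Descent of an equivariant injective map to the coinvariants: the kernel is killed by `2`.**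
Let `𝓛 : M → N` be injective and `R`-linear with `𝓛 (cM x) = cN (𝓛 x)`, and `pr : N → R` linear
with `pr y = 0 ⇒ cN y = −y`. If `pr (𝓛 x) = 0` then `2 • x = (cM − 1)(−x)` lies in the range of
`cM − 1` (so the class of `x` in the coinvariants `M/(cM − 1)M` is `2`-torsion). Model: `𝔏_η` of
Kato's Prop. 17.11 over `ℚ₂(ζ_{2^∞})`, `Λ_G`-linear (Thm. 16.4), `Δ = {1, c}` (12.1), `pr : Λ_G →
ℤ₂⟦G¹_∞⟧` the projection `c ↦ 1`. [cite: Kato2004Asterisque, 12.1 (pp. 219–220), Thm. 16.4 (p. 270), Prop. 17.11 (p. 277)] -/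
theorem two_smul_mem_range_of_descent (cM : M →ₗ[R] M) (cN : N →ₗ[R] N) (𝓛 : M →ₗ[R] N)
    (h𝓛 : Function.Injective 𝓛) (hcomm : ∀ x : M, 𝓛 (cM x) = cN (𝓛 x)) (pr : N →ₗ[R] R)
    (hker : ∀ y : N, pr y = 0 → cN y = -y) {x : M} (hx : pr (𝓛 x) = 0) :
    (2 : R) • x ∈ LinearMap.range (cM - LinearMap.id) := by
  have h1 : cN (𝓛 x) = -𝓛 x := hker _ hx
  have h2 : cM x = -x := by
    apply h𝓛
    rw [hcomm, h1, map_neg]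
  refine ⟨-x, ?_⟩
  rw [LinearMap.sub_apply, LinearMap.id_apply, map_neg, h2, neg_neg, sub_neg_eq_add, two_smul]

/-- **The descended Coleman map is injective up to `2`-torsion.** In the situation of
`two_smul_mem_range_of_descent`, assume moreover `pr (cN y) = pr y` (so `pr ∘ 𝓛` kills
`(cM − 1)M`) and let `col : M/(cM − 1)M → R` be the induced map (`Submodule.liftQ`). Then
`col q = 0 ⇒ 2 • q = 0`. [cite: Kato2004Asterisque, 12.1 (pp. 219–220), Prop. 17.11 (p. 277)] -/
theorem two_smul_eq_zero_of_descent (cM : M →ₗ[R] M) (cN : N →ₗ[R] N) (𝓛 : M →ₗ[R] N)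
    (h𝓛 : Function.Injective 𝓛) (hcomm : ∀ x : M, 𝓛 (cM x) = cN (𝓛 x)) (pr : N →ₗ[R] R)
    (hker : ∀ y : N, pr y = 0 → cN y = -y)
    (hle : LinearMap.range (cM - LinearMap.id) ≤ LinearMap.ker (pr ∘ₗ 𝓛))
    (q : M ⧸ LinearMap.range (cM - LinearMap.id))
    (hq : (LinearMap.range (cM - LinearMap.id)).liftQ (pr ∘ₗ 𝓛) hle q = 0) :
    (2 : R) • q = 0 := by
  obtain ⟨x, rfl⟩ := Submodule.Quotient.mk_surjective _ q
  rw [Submodule.liftQ_apply, LinearMap.comp_apply] at hq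
  rw [← Submodule.Quotient.mk_smul, Submodule.Quotient.mk_eq_zero]
  exact two_smul_mem_range_of_descent cM cN 𝓛 h𝓛 hcomm pr hker hq

/-- The compatibility `pr ∘ cN = pr` makes `pr ∘ 𝓛` vanish on `(cM − 1)M` (so that it descends to
the coinvariants): the projection `Λ_G = O[Δ]⟦G¹_∞⟧ → O⟦G¹_∞⟧`, `c ↦ 1`, is constant on
`Δ`-orbits. [cite: Kato2004Asterisque, 12.1 (pp. 219–220; Λ = O_λ[Δ][[G¹_∞]], Δ the torsion part of G_∞)] -/
theorem range_sub_id_le_ker_of_descent (cM : M →ₗ[R] M) (cN : N →ₗ[R] N) (𝓛 : M →ₗ[R] N)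
    (hcomm : ∀ x : M, 𝓛 (cM x) = cN (𝓛 x)) (pr : N →ₗ[R] R) (hpr : ∀ y : N, pr (cN y) = pr y) :
    LinearMap.range (cM - LinearMap.id) ≤ LinearMap.ker (pr ∘ₗ 𝓛) := by
  rintro _ ⟨x, rfl⟩
  rw [LinearMap.mem_ker, LinearMap.comp_apply, LinearMap.sub_apply, LinearMap.id_apply, map_sub,
    map_sub, hcomm, hpr, sub_self]

/-- A composite of two injective linear maps is injective — the two-line proof of Kato's
Prop. 17.11 (p. 277): `𝔏_η` on `𝐇¹_loc(T(k))/𝐇¹_loc(T′(k))` is (the injection into `𝐇¹_loc(T″(k))`)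
followed by (the injection `𝐇¹_loc(T″(k)) ↪ Λ` of Lemma 17.12). [cite: Kato2004Asterisque, Prop. 17.11 and Lemma 17.12 (pp. 277–279)] -/
theorem injective_of_factorisation {M₂ : Type*} [AddCommGroup M₂] [_root_.Module R M₂]
    (π : M →ₗ[R] M₂) (col₂ : M₂ →ₗ[R] N) (𝓛 : M →ₗ[R] N) (hfac : ∀ x : M, 𝓛 x = col₂ (π x))
    (hπ : Function.Injective π) (hcol₂ : Function.Injective col₂) : Function.Injective 𝓛 := by
  intro x y hxy
  rw [hfac, hfac] at hxy
  exact hπ (hcol₂ hxy)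

end Descent

/-! ### Over `Λ = ℤ_p⟦T⟧`: the tree's form of Thm. 17.4 (1)(2) with both defects -/

section Iwasawa

variable (p : ℕ) [Fact p.Prime]
  {H P X H2 H2loc : Type*} [AddCommGroup H] [_root_.Module (IwasawaAlgebra p) H]
  [AddCommGroup P] [_root_.Module (IwasawaAlgebra p) P]
  [AddCommGroup X] [_root_.Module (IwasawaAlgebra p) X]
  [AddCommGroup H2] [_root_.Module (IwasawaAlgebra p) H2]
  [AddCommGroup H2loc] [_root_.Module (IwasawaAlgebra p) H2loc]

/-- **Kato, Thm. 17.4 (1)–(2) for `Λ = ℤ_p⟦T⟧`, tree form, (17.13.1) exact up to `×c` and the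
Coleman map injective up to `c`-torsion.** As `exists_mem_charIdeal_of_skeleton_upTo` (file
`KatoRankBoundAllPrimesSkeletonProofs`) with `Injective col` weakened to `col y = 0 ⇒ c • y = 0`,
for a `c ≠ 0` lying in no height-one prime `𝔭 ∌ p` (e.g. `c = 2·p^a`,
`two_mul_natCast_pow_ne_zero_and_not_mem`): `X` is `Λ`-torsion and `p^m · L ∈ ι(char_Λ X)` for some
`m`, whenever `ι G = p^n · L`, `G ∈ col(loc Z)`, `G ≠ 0`, the Euler-system bound of Thm. 12.5 (3) in
its printed shape holds at the height-one `𝔭 ∌ p` and the `𝐇²_loc`-term vanishes there.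
[cite: Kato2004Asterisque, Thm 17.4 (1)(2) (p. 273), §17.13 (pp. 279–280), 14.9 (p. 239)] -/
theorem exists_mem_charIdeal_of_skeleton_kerUpTo [Module.Finite (IwasawaAlgebra p) X]
    [Module.IsTorsionFree (IwasawaAlgebra p) H] (hrank : Module.rank (IwasawaAlgebra p) H ≤ 1)
    {c : IwasawaAlgebra p} (hc0 : c ≠ 0)
    (hc : ∀ 𝔭 : PrimeSpectrum (IwasawaAlgebra p), 𝔭.asIdeal.height = 1 →
      PowerSeries.C (p : ℤ_[p]) ∉ 𝔭.asIdeal → c ∉ 𝔭.asIdeal)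
    (loc : H →ₗ[IwasawaAlgebra p] P) (toX : P →ₗ[IwasawaAlgebra p] X)
    (δ : X →ₗ[IwasawaAlgebra p] H2) (hPX : ∀ h : H, c • toX (loc h) = 0)
    (hXH : ∀ x : X, δ x = 0 → c • x ∈ LinearMap.range toX)
    (col : P →ₗ[IwasawaAlgebra p] IwasawaAlgebra p) (hcol : ∀ y : P, col y = 0 → c • y = 0)
    (hH2 : Module.IsTorsion (IwasawaAlgebra p) H2)
    (Z : Submodule (IwasawaAlgebra p) H) {G : IwasawaAlgebra p} (hG : G ≠ 0)
    (hGZ : G ∈ Submodule.map (col ∘ₗ loc) Z)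
    (hES : ∀ 𝔭 : PrimeSpectrum (IwasawaAlgebra p), 𝔭.asIdeal.height = 1 →
      PowerSeries.C (p : ℤ_[p]) ∉ 𝔭.asIdeal →
        lengthAt (IwasawaAlgebra p) H2 𝔭 ≤
          lengthAt (IwasawaAlgebra p) (H ⧸ Z) 𝔭 + lengthAt (IwasawaAlgebra p) H2loc 𝔭)
    (hH2loc : ∀ 𝔭 : PrimeSpectrum (IwasawaAlgebra p), 𝔭.asIdeal.height = 1 →
      PowerSeries.C (p : ℤ_[p]) ∉ 𝔭.asIdeal → lengthAt (IwasawaAlgebra p) H2loc 𝔭 = 0)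
    {L : PowerSeries ℚ_[p]} {n : ℕ}
    (hιG : iwasawaToPowerSeries p G = PowerSeries.C ((p : ℚ_[p]) ^ n) * L) :
    Module.IsTorsion (IwasawaAlgebra p) X ∧
      ∃ (m : ℕ) (g : IwasawaAlgebra p), g ∈ charIdeal (IwasawaAlgebra p) X ∧
        iwasawaToPowerSeries p g = PowerSeries.C ((p : ℚ_[p]) ^ m) * L := by
  obtain ⟨htors, hlen⟩ :=
    thm17_4_skeleton_kerUpTo hrank hc0 loc toX δ hPX hXH col hcol hH2 Z hG hGZ
  refine ⟨htors, ?_⟩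
  obtain ⟨m, hm⟩ := exists_pow_mul_mem_charIdeal_of_lengthAt_le htors (IwasawaAlgebra.prime_C p)
    hG fun 𝔭 h1 hp𝔭 => hlen 𝔭 (hc 𝔭 h1 hp𝔭) (by simpa [hH2loc 𝔭 h1 hp𝔭] using hES 𝔭 h1 hp𝔭)
  refine ⟨m + n, PowerSeries.C (p : ℤ_[p]) ^ m * G, hm, ?_⟩
  rw [map_mul, map_pow, hιG, PowerSeries.map_C, map_natCast, ← mul_assoc, ← map_pow, ← map_mul,
    ← pow_add]

/-- `2`, as an element of `Λ = ℤ_p⟦T⟧`, lies in no height-one prime `𝔭 ∌ p` — for EVERY prime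
`p`: at `p = 2` because `𝔭 ∌ 2 = p`; at odd `p` because `2` is a unit of `ℤ_p` (hence of `Λ`) —
the localisation at the height-one `𝔭 ∌ p` where Kato reads Thm. 17.4 (2) ("which does not
contain `p`", p. 273; (12.1.4): `Λ_𝔭` is a discrete valuation ring except in the case `p = 2 ∈ 𝔭`).
[cite: Kato2004Asterisque, (12.1.4) (p. 220) and Thm. 17.4 (2) (p. 273; height-one primes not containing p)] -/
theorem two_not_mem_of_heightOne (𝔭 : PrimeSpectrum (IwasawaAlgebra p))
    (hp𝔭 : PowerSeries.C (p : ℤ_[p]) ∉ 𝔭.asIdeal) : (2 : IwasawaAlgebra p) ∉ 𝔭.asIdeal := by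
  by_cases hp2 : p = 2
  · subst hp2
    have h2 : (2 : IwasawaAlgebra 2) = PowerSeries.C ((2 : ℕ) : ℤ_[2]) := by
      rw [Nat.cast_ofNat, map_ofNat]
    rw [h2]
    exact hp𝔭
  · intro hmem
    apply 𝔭.isPrime.ne_top
    refine Ideal.eq_top_of_isUnit_mem _ hmem ?_
    have hu : IsUnit (2 : ℤ_[p]) := by
      rw [PadicInt.isUnit_iff]
      have h22 : (2 : ℤ_[p]) = ((2 : ℕ) : ℤ_[p]) := by norm_num
      rw [h22, PadicInt.norm_natCast_eq_one_iff]
      exact (Nat.coprime_primes (Fact.out : p.Prime) Nat.prime_two).mpr hp2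
    have : (2 : IwasawaAlgebra p) = PowerSeries.C (2 : ℤ_[p]) := by
      rw [map_ofNat]
    rw [this, PowerSeries.isUnit_iff_constantCoeff, PowerSeries.constantCoeff_C]
    exact hu

/-- `2·p^a`, as an element of `Λ = ℤ_p⟦T⟧`, is non-zero and lies in no height-one prime `𝔭 ∌ p`
(any prime `p`): the admissible joint defect constant for `exists_mem_charIdeal_of_skeleton_kerUpTo`
(Poitou–Tate defects `p^a` — (17.13.1) "exact upto `×2`", p. 279 — and the Coleman-descent
defect `2`). [cite: Kato2004Asterisque, (12.1.4) (p. 220), §17.13 (17.13.1) (p. 279) and Thm. 17.4 (2) (p. 273; height-one primes not containing p)] -/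
theorem two_mul_natCast_pow_ne_zero_and_not_mem (a : ℕ) :
    ((2 : IwasawaAlgebra p) * (p : IwasawaAlgebra p) ^ a ≠ 0) ∧
      ∀ 𝔭 : PrimeSpectrum (IwasawaAlgebra p), 𝔭.asIdeal.height = 1 →
        PowerSeries.C (p : ℤ_[p]) ∉ 𝔭.asIdeal →
          (2 : IwasawaAlgebra p) * (p : IwasawaAlgebra p) ^ a ∉ 𝔭.asIdeal := by
  obtain ⟨hpa, hpa'⟩ := natCast_pow_ne_zero_and_not_mem p a
  have h2 : (2 : IwasawaAlgebra p) ≠ 0 := by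
    rw [Ne, show (2 : IwasawaAlgebra p) = PowerSeries.C (2 : ℤ_[p]) by rw [map_ofNat],
      map_eq_zero_iff _ (PowerSeries.C_injective)]
    exact two_ne_zero
  refine ⟨mul_ne_zero h2 hpa, fun 𝔭 h1 hp𝔭 hmem => ?_⟩
  rcases 𝔭.isPrime.mem_or_mem hmem with h | h
  · exact two_not_mem_of_heightOne p 𝔭 hp𝔭 h
  · exact hpa' 𝔭 h1 hp𝔭 h

end Iwasawa

end Kato2004

end Literature.NumberTheory.EllipticCurves

end
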